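import Summits.BirchSwinnertonDyer.Rank1Residual.X11b.KummerPoitouTateExact
import HarnessLib

/-!
# Poitou–Tate exactness for the Kummer structure of `E[p^k]` WITHOUT the «all infinite places complex» hypothesis,
# for `S'` containing the infinite places — the archimedean input (M3) of the Cassels-via-Poitou–Tate plan for K4

Crux K4 `SignedControlAtTwo` (stmt-BirchSwinnertonDyer-20309; routes `ThetaPartnerAtTwo` / `ResidualThetaTransportAtTwo`), line
`eulerchar` v8; width seat `prover-bsd-wall-tp2-p3-w3` g4. Context: after this seat's `h1Sigma_zpCorank_le_degree_holds_rat` the K4 PUB residue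
is {Cassels (Greenberg Prop. 4.13 / p. 122), Prop. 4.12, weak Leopoldt or Thm. 1.7}. Cassels over `ℚ` reduces to the EXISTENCE half of
Poitou–Tate for the Kummer structure at one finite level (`Cruxes/SignedControlAtTwo/CASSELS-VIA-PT-PLAN.md`), which the tree has as
`X11b.KummerPT.exists_mem_kummerOutside_localization_eq` — conditional on `LocalInvariants.SelmerComplement` and stated for number fields
ALL of whose infinite places are COMPLEX (`hK`), which excludes `ℚ`. The hypothesis `hK` is used only to dispose of the dual local
condition at an infinite place OUTSIDE `S'`. For Cassels `Σ ⊇ ∞`, so the right generality is: **`S'` contains every infinite place** —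
then no archimedean duality is needed at all. This file records that variant, verbatim otherwise:

* `map_weilDualInv_mem_kummerOutside_of_mem_dualSelmerGroup_of_inl_mem` — the Weil transport of a dual Selmer class for
  `(kummerStrict S')^*` lies in `kummerOutside W n S'` when `S' ⊇ ∞` (finite places `v ∉ S'`: the tree's
  `map_weilDualInv_mem_kummer_of_mem_dualLocalCondition`; infinite places: none outside `S'`);
* `exists_mem_kummerOutside_localization_eq_of_inl_mem` — POITOU–TATE EXACTNESS for the Kummer structure of `E[p^k]` on any `S' ⊇ ∞`,
  every number field `K : Type` (real places allowed), conditional on `IsPerfect`, `SelmerComplement` of the family and Tate's count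
  `hEuler` (the latter a THEOREM of the tree at every finite place: `natCard_galoisCohomology_one_torsion_adicCompletion_eq_sq` +
  `localEulerPoincareCharacteristic_holds`; kept as a hypothesis to stay verbatim with the X11b file).

THEOREMS ONLY (no definition, no named fact, no `sorry`); CONDITIONAL on the displayed Poitou–Tate properties; proves no case of BSD.

References: [Howard2004HeegnerKolyvagin] Thm. 2.1.11; [MilneADT2006] I Cor. 2.3, Thm. 2.8, Cor. 3.4, Thm. 4.10(b), Lemma 6.15;
[GreenbergLNM1716] §4 Prop. 4.13 / p. 122.
-/

set_option autoImplicit false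
-- the Theorems namespace of this sub repeats the summit name by design (D-0017 nested layout)
set_option linter.dupNamespace false

noncomputable section

open scoped Classical

open CategoryTheory Field NumberField IsDedekindDomain Function
open Literature.NumberTheory.EllipticCurves Literature.NumberTheory.EllipticCurves.GreenbergSelmer
open Literature.NumberTheory.GaloisRepresentations
open Literature.NumberTheory.GaloisRepresentations.DiscreteGaloisModule (SelmerStructure TateDual
  tateDual localTatePairingZMod unramifiedSubgroup mu MuCarrier)
open Literature.NumberTheory.GaloisCohomology
open scoped ContRepresentation

namespace Summit.BirchSwinnertonDyer.BirchSwinnertonDyer.Theorems.SignedEC.CasselsViaPT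

open Summit.BirchSwinnertonDyer.Rank1Residual.X11b Summit.BirchSwinnertonDyer.Rank1Residual.X11b.KummerPT
open Summit.BirchSwinnertonDyer.Rank1Residual.X11b.LocBridge
open Summit.BirchSwinnertonDyer.Rank1Residual.X11b.Levels
open Summit.BirchSwinnertonDyer.Rank1Residual.X11b.AcSelmer
open Summit.BirchSwinnertonDyer.Rank1Residual.X11b.FiniteDuality
open Summit.BirchSwinnertonDyer.Rank1Residual.X11b.Relaxation

-- Cup products need `LocallyCompactSpace Γ`; finiteness of `E[p^k]`, `NeZero (p^k)`: local instances (as in the X11b file).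
attribute [local instance] absoluteGaloisGroup_compactSpace Levels.neZero_pow finite_geomTorsion_pow
  finite_geomTorsion_of_neZero Literature.NumberTheory.EllipticCurves.finite_muCarrier

variable {K : Type} [Field K] [NumberField K] (W : WeierstrassCurve K) [W.IsElliptic] (p k : ℕ)
  [Fact p.Prime]

/-! ## §1 The Weil transport of a dual Selmer class, `S' ⊇ ∞` -/

section LocalDual

variable (n : ℕ) [NeZero n]
variable (e : W.geomTorsion n → W.geomTorsion n → AlgebraicClosure K)
  (hμ : ∀ S T, e S T ^ n = 1)
  (hadd₁ : ∀ S₁ S₂ T, e (S₁ + S₂) T = e S₁ T * e S₂ T)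
  (hadd₂ : ∀ S T₁ T₂, e S (T₁ + T₂) = e S T₁ * e S T₂)
  (hgal : ∀ (σ : absoluteGaloisGroup K) (S T : W.geomTorsion n), σ • e S T = e (σ • S) (σ • T))
  (halt : ∀ T, e T T = 1) (hnondeg : ∀ T, (∀ S, e S T = 1) → T = 0)
  (inv : LocalInvariants K n)

include halt hnondeg in
/-- **The Weil transport of a dual Selmer class for `(kummerStrict S')^*` lies in `kummerOutside W n S'`, for `S'` containing every
infinite place** (any number field, real places allowed): at a finite `v ∉ S'` the dual condition is `𝓛_v^*`, transported into `𝓛_v` by the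
tree's `map_weilDualInv_mem_kummer_of_mem_dualLocalCondition` (`inv_v` injective, Tate's count); there is no infinite place outside `S'`.
[cite: MilneADT2006, Ch. I §6, proof of Prop. 6.9] [cite: Howard2004HeegnerKolyvagin, Def. 2.1.10] -/
theorem map_weilDualInv_mem_kummerOutside_of_mem_dualSelmerGroup_of_inl_mem (S' : Finset (Place K))
    (hS' : ∀ w : InfinitePlace K, (Sum.inl w : Place K) ∈ S')
    (hinv : ∀ v : HeightOneSpectrum (𝓞 K), (Sum.inr v : Place K) ∉ S' → Injective (inv (Sum.inr v)))
    (hEuler : ∀ v : HeightOneSpectrum (𝓞 K), (Sum.inr v : Place K) ∉ S' →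
      Nat.card (galoisCohomology ((W.torsionGaloisModule n).toLocal (Sum.inr v)) 1) =
        (Nat.card (nsmulAddMonoidHom n : (W.baseChange (v.adicCompletion K)).toAffine.Point →+ _).ker *
          Nat.card (v.adicCompletionIntegers K ⧸ Ideal.span {(n : v.adicCompletionIntegers K)})) ^ 2)
    {y : galoisCohomology ((W.torsionGaloisModule n).tateDual n) 1}
    (hy : y ∈ (inv.dualSelmerStructure (W.torsionGaloisModule n) (kummerStrict W n S')).selmerGroup) :
    galoisCohomology.map (weilDualInv W n e hμ hadd₁ hadd₂ hgal hnondeg) 1 y ∈ kummerOutside W n S' := by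
  set yW := galoisCohomology.map (weilDualInv W n e hμ hadd₁ hadd₂ hgal hnondeg) 1 y with hyWdef
  rw [mem_kummerOutside_iff]
  intro v hv
  have hyv := (SelmerStructure.mem_selmerGroup_iff _ y).mp hy v
  rw [LocalInvariants.dualSelmerStructure_apply, kummerStrict_of_not_mem W n S' hv] at hyv
  change galoisCohomology.localization (W.torsionGaloisModule (n : ℤ)) v 1 yW ∈
    W.kummerSelmerStructure (n : ℤ) v
  cases v with
  | inl w => exact absurd (hS' w) hv
  | inr v =>
    rw [hyWdef, localization_map_one]
    exact map_weilDualInv_mem_kummer_of_mem_dualLocalCondition W n e hμ hadd₁ hadd₂ hgal halt hnondeg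
      inv v (hinv v hv) (hEuler v hv) hyv

end LocalDual

/-! ## §2 Poitou–Tate exactness for the Kummer structure, `S' ⊇ ∞`, any number field -/

section Exactness

variable (e : W.geomTorsion ((p ^ k : ℕ) : ℤ) → W.geomTorsion ((p ^ k : ℕ) : ℤ) → AlgebraicClosure K)
  (hμ : ∀ S T, e S T ^ (p ^ k) = 1)
  (hadd₁ : ∀ S₁ S₂ T, e (S₁ + S₂) T = e S₁ T * e S₂ T)
  (hadd₂ : ∀ S T₁ T₂, e S (T₁ + T₂) = e S T₁ * e S T₂)
  (hgal : ∀ (σ : absoluteGaloisGroup K) (S T : W.geomTorsion ((p ^ k : ℕ) : ℤ)),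
    σ • e S T = e (σ • S) (σ • T))
  (halt : ∀ T, e T T = 1) (hnondeg : ∀ T, (∀ S, e S T = 1) → T = 0)

include halt hnondeg in
/-- **POITOU–TATE EXACTNESS FOR THE KUMMER STRUCTURE on `S' ⊇ ∞`, every number field** (Milne I Thm. 4.10(b) `Ker γ¹ ⊆ Im β¹` at
`⊕_{v∈S'} H¹(K_v, E[p^k])`, from the CITED `SelmerComplement`): for a Poitou–Tate family `inv` at level `p^k` with `IsPerfect` and
`SelmerComplement`, Tate's count at every finite place, and a finite set of places `S'` CONTAINING EVERY INFINITE PLACE: if local classes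
`t_v ∈ H¹(K_v, E[p^k])` (`v ∈ S'`) satisfy `∑_{v∈S'} inv_v(t_v ∪ₑ loc_v c) = 0` for every `c ∈ kummerOutside W (p^k) S'`, then `t_v = loc_v x`
on `S'` for some `x ∈ kummerOutside W (p^k) S'`. Verbatim the X11b proof with §1 in place of its totally-complex lemma.
[cite: Howard2004HeegnerKolyvagin, Thm. 2.1.11 (arXiv:1202.6340 p. 6)] [cite: MilneADT2006, Ch. I, Thm. 4.10(b) and Lemma 6.15] -/
theorem exists_mem_kummerOutside_localization_eq_of_inl_mem
    {inv : LocalInvariants K (p ^ k)} (hperf : inv.IsPerfect) (hcompl : inv.SelmerComplement)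
    (hEuler : ∀ v : HeightOneSpectrum (𝓞 K),
      Nat.card (galoisCohomology ((W.torsionGaloisModule ((p ^ k : ℕ) : ℤ)).toLocal (Sum.inr v)) 1) =
        (Nat.card (nsmulAddMonoidHom (p ^ k) :
            (W.baseChange (v.adicCompletion K)).toAffine.Point →+ _).ker *
          Nat.card (v.adicCompletionIntegers K ⧸
            Ideal.span {((p ^ k : ℕ) : v.adicCompletionIntegers K)})) ^ 2)
    (S' : Finset (Place K)) (hS' : ∀ w : InfinitePlace K, (Sum.inl w : Place K) ∈ S')
    (t : Π v : Place K, galoisCohomology ((W.torsionGaloisModule ((p ^ k : ℕ) : ℤ)).toLocal v) 1)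
    (ht : ∀ c ∈ kummerOutside W (p ^ k) S',
      ∑ v ∈ S', invWeilPairing W (p ^ k) e hμ hadd₁ hadd₂ hgal inv v (t v)
        (galoisCohomology.localization (W.torsionGaloisModule ((p ^ k : ℕ) : ℤ)) v 1 c) = 0) :
    ∃ x ∈ kummerOutside W (p ^ k) S', ∀ v ∈ S',
      galoisCohomology.localization (W.torsionGaloisModule ((p ^ k : ℕ) : ℤ)) v 1 x = t v := by
  classical
  obtain ⟨T, hS'T, hinf, hp, hbad⟩ := exists_exceptional_finset W p S'
  have hMn : ∀ m : W.geomTorsion ((p ^ k : ℕ) : ℤ), (p ^ k) • m = 0 := fun m ↦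
    AddSubgroup.torsionBy.nsmul m
  have hTout : ∀ v : HeightOneSpectrum (𝓞 K), (Sum.inr v : Place K) ∉ T →
      ((p ^ k : ℕ) : 𝓞 K) ∉ v.asIdeal ∧
        GaloisRep.IsUnramifiedAt v (W.torsionGaloisModule ((p ^ k : ℕ) : ℤ)) := by
    intro v hv
    have hpv : ((p : ℕ) : 𝓞 K) ∉ v.asIdeal := fun h ↦ hv (hp v h)
    have hgood : W.HasGoodReductionAt v := by
      by_contra hbad'
      exact hv (hbad v hbad')
    exact ⟨natCast_pow_not_mem p hpv _,
      isUnramifiedAt_torsionGaloisModule W hgood (intCast_pow_not_mem p hpv _)⟩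
  -- the test family, extended by zero off `S'`
  set t' : Π v : Place K, galoisCohomology ((W.torsionGaloisModule ((p ^ k : ℕ) : ℤ)).toLocal v) 1 :=
    fun v ↦ if v ∈ S' then t v else 0 with ht'def
  have ht'mem : ∀ v ∈ S', t' v = t v := fun v hv ↦ by rw [ht'def]; exact if_pos hv
  have ht'not : ∀ v ∉ S', t' v = 0 := fun v hv ↦ by rw [ht'def]; exact if_neg hv
  have ht' : ∀ v ∈ T, t' v ∈ kummerRelaxed W (p ^ k) S' v := by
    intro v _
    by_cases hv : v ∈ S'
    · rw [kummerRelaxed_of_mem W (p ^ k) S' hv]; exact AddSubgroup.mem_top _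
    · rw [ht'not v hv]; exact zero_mem _
  -- Poitou–Tate
  obtain ⟨x, hx, hxt⟩ := (hcompl (W.torsionGaloisModule ((p ^ k : ℕ) : ℤ)) hMn T hTout
    (kummerStrict W (p ^ k) S') (kummerRelaxed W (p ^ k) S') (kummerStrict_le_kummerRelaxed W (p ^ k) S')
    (kummerStrict_isUnramifiedOutside W p k S' T hS'T hinf hp hbad)
    (kummerRelaxed_isUnramifiedOutside W p k S' T hS'T hinf hp hbad)).1 t' ht' (fun y hy ↦ by
      -- the obstruction vanishes
      set yW := galoisCohomology.map (weilDualInv W (p ^ k) e hμ hadd₁ hadd₂ hgal hnondeg) 1 y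
        with hyWdef
      have hyW : galoisCohomology.map (weilDualIntertwining W (p ^ k) e hμ hadd₁ hadd₂ hgal) 1 yW = y :=
        map_weilDual_map_weilDualInv W (p ^ k) e hμ hadd₁ hadd₂ hgal hnondeg y
      have hyKO : yW ∈ kummerOutside W (p ^ k) S' :=
        map_weilDualInv_mem_kummerOutside_of_mem_dualSelmerGroup_of_inl_mem W (p ^ k) e hμ hadd₁ hadd₂ hgal halt
          hnondeg inv S' hS' (fun v _ ↦ (hperf v).1.1) (fun v _ ↦ hEuler v) hy
      have hterm : ∀ v : Place K,
          localTatePairingZMod (W.torsionGaloisModule ((p ^ k : ℕ) : ℤ)) (p ^ k) v (inv v) (t' v)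
            (galoisCohomology.localization
              ((W.torsionGaloisModule ((p ^ k : ℕ) : ℤ)).tateDual (p ^ k)) v 1 y) =
          invWeilPairing W (p ^ k) e hμ hadd₁ hadd₂ hgal inv v (t' v)
            (galoisCohomology.localization (W.torsionGaloisModule ((p ^ k : ℕ) : ℤ)) v 1 yW) := by
        intro v
        rw [← hyW, localization_map_one, localTatePairingZMod_map_weilDual, invWeilPairing_apply]
      calc ∑ v ∈ T, localTatePairingZMod (W.torsionGaloisModule ((p ^ k : ℕ) : ℤ)) (p ^ k) v (inv v)
              (t' v) (galoisCohomology.localization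
                ((W.torsionGaloisModule ((p ^ k : ℕ) : ℤ)).tateDual (p ^ k)) v 1 y)
          = ∑ v ∈ T, invWeilPairing W (p ^ k) e hμ hadd₁ hadd₂ hgal inv v (t' v)
              (galoisCohomology.localization (W.torsionGaloisModule ((p ^ k : ℕ) : ℤ)) v 1 yW) :=
            Finset.sum_congr rfl fun v _ ↦ hterm v
        _ = ∑ v ∈ S', invWeilPairing W (p ^ k) e hμ hadd₁ hadd₂ hgal inv v (t' v)
              (galoisCohomology.localization (W.torsionGaloisModule ((p ^ k : ℕ) : ℤ)) v 1 yW) := by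
            refine (Finset.sum_subset hS'T fun v _ hvS' ↦ ?_).symm
            rw [ht'not v hvS', map_zero, AddMonoidHom.zero_apply]
        _ = ∑ v ∈ S', invWeilPairing W (p ^ k) e hμ hadd₁ hadd₂ hgal inv v (t v)
              (galoisCohomology.localization (W.torsionGaloisModule ((p ^ k : ℕ) : ℤ)) v 1 yW) :=
            Finset.sum_congr rfl fun v hv ↦ by rw [ht'mem v hv]
        _ = 0 := ht yW hyKO)
  refine ⟨x, ?_, fun v hv ↦ ?_⟩
  · rw [← selmerGroup_kummerRelaxed W (p ^ k) S']
    exact hx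
  · have h := hxt v (hS'T hv)
    rw [kummerStrict_of_mem W (p ^ k) S' hv, AddSubgroup.mem_bot, sub_eq_zero, ht'mem v hv] at h
    exact h

end Exactness

end Summit.BirchSwinnertonDyer.BirchSwinnertonDyer.Theorems.SignedEC.CasselsViaPT

end
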